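import Mathlib

/-!
# The perfect4 block certificate, part 1: the PROFILE LEMMA (a finite inequality between sorted fibre profiles)

Support file of the one-cut programme (crux `NoHeavyLowerTail`, stmt-CriticalPhenomena-4575; unit `prim-lf-1` gen 57, memo
`FROM-prim-lf-1-gen57-PERFECT4.md` §4, §4b).  The PERFECT4 BLOCK THEOREM — `P₁ ∧ perfect4` is an intersecting Kleitman shell for every intersecting
Kleitman shell `P₁`, where `perfect4 = x₀(x₁ ∨ x₂ ∨ x₃) ∨ x₁x₂x₃` — has a four-term "local certificate" found by a complete linear programme with
max-flow column generation and verified in exact arithmetic (gen 57).  Its combinatorial core is the inequality of this file.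

For a point `x` of `P₁` and an up-set `A` of the product cube write `u = δ_A(x,⊤)`, `g = δ_A(x,{1,2,3})`, `p₁ ≤ p₂ ≤ p₃` for the sorted values
`δ_A(x,{0,a})` and `T₁ ≤ T₂ ≤ T₃` for the sorted values `δ_A(x,{0,b,c})` (`δ_A(z) = [z ∈ A] − [zᶜ ∈ A] ∈ {−1,0,1}`).  Such a SORTED PROFILE
satisfies `g ≤ u`, `T₃ ≤ u`, `p₃ ≤ u`, `p₂ ≤ T₁`, `p₃ ≤ T₂` (and these five constraints characterise the 122 profiles exactly).  With
`M = max g T₃`, `F = [min(g,p₁) = 1] − [p₁ = −1 ∧ min(g,T₃) = −1]`,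
`E = [(p₁ = 1 ∧ g ≥ 0) ∨ (g = 1 ∧ T₃ = 1 ∧ T₁ ≥ 0 ∧ p₁ ≥ 0)] − [(g = −1 ∧ p₁ ≤ 0) ∨ (p₁ = −1 ∧ min(g,T₃) ≤ 0)]`
the **Profile Lemma** `profile_ineq` states, for two profiles `π, π'`:
`2(uu' + gg' + p₁p₃' + p₂p₂' + p₃p₁' + T₁T₃' + T₂T₂' + T₃T₁') ≥ (p₂+T₂)(p₂'+T₂') + (p₃+T₁)(p₃'+T₁') + 2(M F' + F M') + 2(u E' + E u')`.
The left side is (twice) the anti-aligned rearrangement lower bound of `Σ_{y ∈ perfect4} δ_A(x,y) δ_B(x,y)`; the words `p₂+T₂`, `p₃+T₁`, `M`, `F`, `E`, `u`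
are increasing in `x` with the antipodal pair condition, so part 2 (assembly, as in `…SahiCombTriWAndMaj3`) sums the right side to `≥ 0` over `P₁` by
`sum_mul_nonneg_of_unit/_of_two`.  Proof here: one kernel `decide` over all value patterns filtered by the constraints (`profile_ineq_vals`).
HONEST LABEL: a finite computation (an interleaved enumeration visiting the 122 × 122 admissible profile pairs) certified by the kernel with
`decide` under a raised heartbeat budget; standard axioms only. [this work]
-/

namespace Summit.CriticalPhenomena.PercolationContinuityZ3.Theorems

namespace Perfect4Cert

/-- The word `F` of the perfect4 certificate as a function of the profile entries `g, p₁, T₃`. [this work] -/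
def wF (g p₁ T₃ : ℤ) : ℤ :=
  (if g = 1 ∧ p₁ = 1 then 1 else 0) - (if p₁ = -1 ∧ (g = -1 ∨ T₃ = -1) then 1 else 0)

/-- The word `E` of the perfect4 certificate as a function of the profile entries `g, p₁, T₁, T₃`. [this work] -/
def wE (g p₁ T₁ T₃ : ℤ) : ℤ :=
  (if (p₁ = 1 ∧ 0 ≤ g) ∨ (g = 1 ∧ T₃ = 1 ∧ 0 ≤ T₁ ∧ 0 ≤ p₁) then 1 else 0)
    - (if (g = -1 ∧ p₁ ≤ 0) ∨ (p₁ = -1 ∧ (g ≤ 0 ∨ T₃ ≤ 0)) then 1 else 0)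

/-- A sorted fibre profile `(u, g, p₁, p₂, p₃, T₁, T₂, T₃)`. [this work] -/
abbrev Profile : Type := ℤ × ℤ × ℤ × ℤ × ℤ × ℤ × ℤ × ℤ

/-- Twice the anti-aligned (rearrangement) lower bound of the perfect4 row `Σ_y δ_A δ_B` in terms of two profiles. [this work] -/
def lhs2 (π π' : Profile) : ℤ :=
  match π, π' with
  | (u, g, p₁, p₂, p₃, T₁, T₂, T₃), (u', g', q₁, q₂, q₃, S₁, S₂, S₃) =>
      2 * (u * u' + g * g' + p₁ * q₃ + p₂ * q₂ + p₃ * q₁ + T₁ * S₃ + T₂ * S₂ + T₃ * S₁)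

/-- Twice the right-hand side of the certificate: `(p₂+T₂)(p₂'+T₂') + (p₃+T₁)(p₃'+T₁') + 2(M F' + F M') + 2(u E' + E u')`. [this work] -/
def rhs2 (π π' : Profile) : ℤ :=
  match π, π' with
  | (u, g, p₁, p₂, p₃, T₁, T₂, T₃), (u', g', q₁, q₂, q₃, S₁, S₂, S₃) =>
      (p₂ + T₂) * (q₂ + S₂) + (p₃ + T₁) * (q₃ + S₁)
        + 2 * (max g T₃ * wF g' q₁ S₃ + wF g p₁ T₃ * max g' S₃)
        + 2 * (u * wE g' q₁ S₁ S₃ + wE g p₁ T₁ T₃ * u')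

/-- The three admissible values of a `δ`-coordinate. [this work] -/
def vals : List ℤ := [-1, 0, 1]

set_option maxHeartbeats 4000000 in
/-- The Profile Lemma as a closed decidable statement, with the order constraints interleaved so that the kernel only visits admissible
partial profiles (122 × 122 leaves). [this work] -/
theorem profile_ineq_vals :
    ∀ u ∈ vals, ∀ g ∈ vals, g ≤ u → ∀ T₃ ∈ vals, T₃ ≤ u → ∀ T₂ ∈ vals, T₂ ≤ T₃ → ∀ T₁ ∈ vals, T₁ ≤ T₂ →
    ∀ p₃ ∈ vals, p₃ ≤ T₂ → p₃ ≤ u → ∀ p₂ ∈ vals, p₂ ≤ p₃ → p₂ ≤ T₁ → ∀ p₁ ∈ vals, p₁ ≤ p₂ →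
    ∀ u' ∈ vals, ∀ g' ∈ vals, g' ≤ u' → ∀ S₃ ∈ vals, S₃ ≤ u' → ∀ S₂ ∈ vals, S₂ ≤ S₃ → ∀ S₁ ∈ vals, S₁ ≤ S₂ →
    ∀ q₃ ∈ vals, q₃ ≤ S₂ → q₃ ≤ u' → ∀ q₂ ∈ vals, q₂ ≤ q₃ → q₂ ≤ S₁ → ∀ q₁ ∈ vals, q₁ ≤ q₂ →
    rhs2 (u, g, p₁, p₂, p₃, T₁, T₂, T₃) (u', g', q₁, q₂, q₃, S₁, S₂, S₃) ≤ lhs2 (u, g, p₁, p₂, p₃, T₁, T₂, T₃) (u', g', q₁, q₂, q₃, S₁, S₂, S₃) := by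
  decide

/-- Membership in `vals` from the usual trichotomy hypothesis. [this work] -/
theorem mem_vals {a : ℤ} (h : a = -1 ∨ a = 0 ∨ a = 1) : a ∈ vals := by
  rcases h with h | h | h <;> subst h <;> decide

/-- **PROFILE LEMMA** (perfect4 certificate, part 1).  For sorted profiles `π = (u,g,p₁,p₂,p₃,T₁,T₂,T₃)`, `π' = (u',g',q₁,q₂,q₃,S₁,S₂,S₃)` with
entries in `{-1,0,1}` satisfying the order constraints `p₁ ≤ p₂ ≤ p₃`, `T₁ ≤ T₂ ≤ T₃`, `g ≤ u`, `T₃ ≤ u`, `p₃ ≤ u`, `p₂ ≤ T₁`, `p₃ ≤ T₂` (both sides),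
`rhs2 π π' ≤ lhs2 π π'`. [this work] -/
theorem profile_ineq {u g p₁ p₂ p₃ T₁ T₂ T₃ u' g' q₁ q₂ q₃ S₁ S₂ S₃ : ℤ}
    (hu : u = -1 ∨ u = 0 ∨ u = 1) (hg : g = -1 ∨ g = 0 ∨ g = 1) (hp₁ : p₁ = -1 ∨ p₁ = 0 ∨ p₁ = 1) (hp₂ : p₂ = -1 ∨ p₂ = 0 ∨ p₂ = 1)
    (hp₃ : p₃ = -1 ∨ p₃ = 0 ∨ p₃ = 1) (hT₁ : T₁ = -1 ∨ T₁ = 0 ∨ T₁ = 1) (hT₂ : T₂ = -1 ∨ T₂ = 0 ∨ T₂ = 1) (hT₃ : T₃ = -1 ∨ T₃ = 0 ∨ T₃ = 1)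
    (hu' : u' = -1 ∨ u' = 0 ∨ u' = 1) (hg' : g' = -1 ∨ g' = 0 ∨ g' = 1) (hq₁ : q₁ = -1 ∨ q₁ = 0 ∨ q₁ = 1) (hq₂ : q₂ = -1 ∨ q₂ = 0 ∨ q₂ = 1)
    (hq₃ : q₃ = -1 ∨ q₃ = 0 ∨ q₃ = 1) (hS₁ : S₁ = -1 ∨ S₁ = 0 ∨ S₁ = 1) (hS₂ : S₂ = -1 ∨ S₂ = 0 ∨ S₂ = 1) (hS₃ : S₃ = -1 ∨ S₃ = 0 ∨ S₃ = 1)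
    (h12 : p₁ ≤ p₂) (h23 : p₂ ≤ p₃) (hT12 : T₁ ≤ T₂) (hT23 : T₂ ≤ T₃) (hgu : g ≤ u) (hT3u : T₃ ≤ u) (hp3u : p₃ ≤ u) (hp2T1 : p₂ ≤ T₁)
    (hp3T2 : p₃ ≤ T₂) (h12' : q₁ ≤ q₂) (h23' : q₂ ≤ q₃) (hT12' : S₁ ≤ S₂) (hT23' : S₂ ≤ S₃) (hgu' : g' ≤ u') (hT3u' : S₃ ≤ u') (hp3u' : q₃ ≤ u')
    (hp2T1' : q₂ ≤ S₁) (hp3T2' : q₃ ≤ S₂) :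
    rhs2 (u, g, p₁, p₂, p₃, T₁, T₂, T₃) (u', g', q₁, q₂, q₃, S₁, S₂, S₃) ≤ lhs2 (u, g, p₁, p₂, p₃, T₁, T₂, T₃) (u', g', q₁, q₂, q₃, S₁, S₂, S₃) :=
  profile_ineq_vals u (mem_vals hu) g (mem_vals hg) hgu T₃ (mem_vals hT₃) hT3u T₂ (mem_vals hT₂) hT23 T₁ (mem_vals hT₁) hT12
    p₃ (mem_vals hp₃) hp3T2 hp3u p₂ (mem_vals hp₂) h23 hp2T1 p₁ (mem_vals hp₁) h12
    u' (mem_vals hu') g' (mem_vals hg') hgu' S₃ (mem_vals hS₃) hT3u' S₂ (mem_vals hS₂) hT23' S₁ (mem_vals hS₁) hT12'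
    q₃ (mem_vals hq₃) hp3T2' hp3u' q₂ (mem_vals hq₂) h23' hp2T1' q₁ (mem_vals hq₁) h12'

end Perfect4Cert

end Summit.CriticalPhenomena.PercolationContinuityZ3.Theorems
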